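import Summits.QuantumFields.BalabanUV.Beta.GAN24.PerfectResolventFibre
import Summits.QuantumFields.BalabanUV.Beta.GAN24.StripRegularPackaging
import Summits.QuantumFields.BalabanUV.Beta.GAN24.FibreStepResidues

/-!
# `BalabanUV.Beta.GAN24.FibreStripJM` — binder row G-an2-4 ∕ (CONV-C), lineage gan24-p3 (part P3, Woodbury ∕ fibre layer):
# **ROAD P1's (I3′) AT RELATIVE BLOCKING `Lc^m` — THE FIBRE LAYER.**  The re-based fibre function `kFibΔM … m j` of the unit-rescaled (j, m)-resolvent
# `unitK (sfStep Lc j) (smStep d Lc j) (FP.PerfectObjects.KTot (Lc^(j+m)) (Lc^j))` (blocking `N = Lc^(j+m)`, decimation `M = Lc^j`), its EXACT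
# `Lc^m`-block-translation invariance and residue form, the shape `StripRegularKM d Lc m κ Cst` (the `m`-analogue of `ConvCKOfShapes.StripRegularK`,
# road P1 row L10 ∕ (I3′)), its packaging from «(U1) no zero of the blocking-`Lc^(j+m)` fibre determinant on the strip + (U2) a direct sup bound», and the two
# WALL CURRENCIES it yields for the (j, m)-family: `CombesThomas.UniformDecays` (the binder `hK` of `FP.TransportInfinityM.entryHyps_perfCol` ∕
# `FP.SymmetryK.kernelSide_KPerf`, rate `κ∕((d+1)·Lc^m)`) by the Paley–Wiener contour shift, and — together with this lineage's `PerfectResolventFibre.RealRateKM`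
# (X1m-K at the fibre level, gen 13) — `CombesThomas.DecayCauchy` (the binder `hKall`), by `CombesThomas.decayCauchy_of_uniformDecays_supRate` BY NAME

NOT IN PRINT; OUR PROOF (this file: [folklore] bookkeeping over tree theorems BY NAME — integer block arithmetic, additivity of the Bloch character, the
landed contour-shift and interpolation lemmas; NO estimate is proved here: the `j`-uniform strip bound is the shape `StripRegularKM`, asserted of nothing and
discharged at `d = 3` in `GAN24/FibreStripJMHolds`).  HONEST FRAMING (cell contract, verbatim): «discharging `BetaPertH` makes Bałaban's UV stability
UNCONDITIONAL — a real constructive-QFT result; it is NOT the continuum limit and NOT the Clay problem.»  HONEST DEPENDENCY (verbatim): «continuum YM on T⁴ ⇐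
BetaPertH ∧ nine spine estimates (0/9 proved); BetaPertH ⇐ (D1) ∧ (D4) ∧ CAP+tail; G-an2-4 gates asym, D1 and NE2/3/4.»

WHY.  Gen 13 closed road FP's X1m-K (entrywise CONVERGENCE of the (j, m)-family, `RealRateKMHolds.exists_tendsto_KTot_holds`) for every `m ≥ 1`; the
`j`-UNIFORM DECAY of the same family (`hK`) and its Cauchy rate in the weighted `Decays` currency (`hKall`) — the two K-side hypotheses of road FP's
N5b-2 (`TransportInfinityM.entryHyps_perfCol` ∕ `hasSum_transport_m2Tensor_perfCol` ∕ `coarseTensor_perfCol_eq_m2Tensor`, discharged so far only at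
`m = 1` by `FP.KSlotHolds`) and of `FP.SymmetryK` §3–§4 — were left standing (cross-read INFO-3, journal l.11819).  Road P1 obtained them at `m = 1`
from (I3′) `StripRegularK` by `CombesThomasFibreStep.unitDecayK_of_stripRegular` and `CombesThomas.decayCauchy_of_uniformDecays_supRate`; this file is
the same route at relative blocking `Lc^m`.

CONTENT (general `d`, `Lc ≥ 1`, units `sf sm : ℕ → ℝ` where free, adopted units `(sfStep Lc, smStep d Lc)` in the shapes; all [folklore] ∕ [our object]):
* §1 leg geometry under `x′ ↦ x′ + Lc^m • v` at `(N, M) = (Lc^(j+m), Lc^j)`: `legOff_add_zsmul_left∕right`; covariance `kFibM_add_zsmul_left∕right`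
  (`kFibM … (x′ + Lc^m•v) … p = cphase v p · kFibM … p`).
* §2 `kFibΔM Lc sf sm m j a x′ b y′ := cphase (quo (Lc^m) y′ − quo (Lc^m) x′) · kFibM …`; `latticeKernel_kFibM_zero_eq`; **`unitK_KTot_eq_offset`**
  (`unitK (sf j) (sm j) (KTot (Lc^(j+m)) (Lc^j)) x′ y′ a b = [LegOn (Lc^m) …] · Re latticeKernel (kFibΔM … m j a x′ b y′) (quo (Lc^m) x′ − quo (Lc^m) y′)`);
  EXACT INVARIANCE `kFibΔM_add_zsmul_left∕right`; residue form `kFibΔM_eq_repZ` (residues mod `Lc^m`); `kFibΔM_repZ_eq_kFibW` (at box representatives the phase is `1`).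
* §3 [shape] `StripRegularKM d Lc m κ Cst`; `stripRegularKM_of_repZ`; holomorphy `stripHolo_kFibΔM` and the packaging `stripRegular_kFibΔM` ∕
  **`stripRegularKM_of_det_bound`** ((U1) at `N = Lc^(j+m)` + (U2) ⇒ the shape).
* §4 **`uniformDecays_of_stripRegularKM`**: the shape (`κ ≥ 0`) ⇒ `UniformDecays (j ↦ unitK (sfStep Lc j) (smStep d Lc j) (KTot (Lc^(j+m)) (Lc^j))) (Cst·e^{2κ}) (κ∕((d+1)·Lc^m))`.
* §5 `supRate_of_realRateKM` (gen 13's `abs_KTot_succ_sub_le` in `SupRate` form) and **`decayCauchy_of_stripRegularKM_realRateKM`**: the two shapes (`0 ≤ θ < 1`) ⇒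
  `DecayCauchy (same family) (√(2(c∕(1−θ))·Cst·e^{2κ})) (√θ) (κ∕((d+1)·Lc^m)∕2)`.
HONEST: a REDUCTION (kernel-checked); `StripRegularKM` for `m ≥ 2` is proved in `GAN24/FibreStripJMHolds` (d = 3), not here; 0 wall binders instantiated;
NEVER «G-an2-4 closed», NOT BetaPertH, NOT continuum, NOT Clay.

ABSOLUTE RULE (cell, verbatim): «No internally-minted statement may enter as a cited fact. Every hypothesis is either kernel-proved in this package or a
verbatim quotation of a PUBLISHED theorem with page reference.»  Nothing is cited; the one `def … : Prop` (`StripRegularKM`) is a binder SHAPE asserted of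
nothing; one data def (`kFibΔM`); every input is a tree theorem imported BY NAME.
-/

noncomputable section

open Complex Finset Filter Topology
open scoped BigOperators Real
open Literature.MathematicalPhysics.QuantumFieldTheory
open Literature.MathematicalPhysics.QuantumFieldTheory.Balaban1983to89
open Literature.MathematicalPhysics.QuantumFieldTheory.Balaban1983to89.Beta
open Literature.Probability.LatticeModels (TorusSite Torus.proj)
open LatticeForm (quo repZ proj_add_zsmul)
open B4Strip (Strip ofRealVec)
open B4ContourShift (BZ StripRegular latticeKernel latticeKernel_decay ofRealVec_mem_Strip supNorm)
open BlochFibreUniqueness (quo_add_zsmul quo_repZ)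
open BlochFibreMatrix (eq_repZ_add_zsmul_quo stencil pieceMatrix)
open FibreInverseDecay (cphase StripHolo trigPolySymbol stripHolo_cphase)
open ExpKernelCalculus (MKer Decays)
open OneStepResolventKernel (Fib)
open OneStepKernelFamily (legPt)
open B12Sec2to5 (l1)
open Summit.QuantumFields.BalabanUV.Beta.HessKerDressedUnits (unitK)
open Summit.QuantumFields.BalabanUV.Beta.GAN24.CombesThomas (sfStep smStep UniformDecays SupRate DecayCauchy decayCauchy_of_uniformDecays_supRate)
open Summit.QuantumFields.BalabanUV.Beta.GAN24.CombesThomasFibre (LegOn legIdx)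
open Summit.QuantumFields.BalabanUV.Beta.GAN24.CombesThomasFibreStep (kFibW legOff cphase_add_eq_mul cphase_zero_left latticeKernel_cphase_mul_zero
  l1_sub_le_coarse)
open Summit.QuantumFields.BalabanUV.Beta.GAN24.FibreStepResidues (legPt_add_zsmul legIdx_add_zsmul)
open Summit.QuantumFields.BalabanUV.Beta.GAN24.StripRegularPackaging (stripRegular_of_stripHolo stripHolo_kFibW)
open Summit.QuantumFields.BalabanUV.Beta.GAN24.PerfectResolventFibre (kFibM RealRateKM unitK_KTot_eq c_nonneg_of_realRateKM abs_KTot_succ_sub_le)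
open Summit.QuantumFields.BalabanUV.Beta.FP.PerfectObjects (KTot)

namespace Summit.QuantumFields.BalabanUV.Beta.GAN24.FibreStripJM

variable {d : ℕ} {Lc : ℕ} [NeZero Lc]

/-! ## §1 Leg geometry and covariance under `Lc^m`-block translations at `(N, M) = (Lc^(j+m), Lc^j)` -/

omit [NeZero Lc] in
/-- [folklore] `Lc^j · Lc^m = Lc^(j+m)` as an integer cast. -/
theorem cast_pow_mul_pow (j m : ℕ) : ((Lc ^ j * Lc ^ m : ℕ) : ℤ) = ((Lc ^ (j + m) : ℕ) : ℤ) := by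
  rw [← pow_add]

/-- [folklore] The block offset (blocking `Lc^(j+m)`) of a leg pair on the step-`j` lattice shifts by `+v` when the first base point is translated by `Lc^m • v`. -/
theorem legOff_add_zsmul_left (m j : ℕ) (a b : Fib d) (x' y' v : Fin (d + 1) → ℤ) (i i' : (Fin (d + 1) → ℕ) × ℕ) :
    legOff (Lc ^ (j + m)) (Lc ^ j) a (x' + ((Lc ^ m : ℕ) : ℤ) • v) i b y' i' = legOff (Lc ^ (j + m)) (Lc ^ j) a x' i b y' i' + v := by
  unfold legOff
  rw [legPt_add_zsmul, cast_pow_mul_pow, quo_add_zsmul]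
  abel

/-- [folklore] … and by `−v` when the second base point is translated by `Lc^m • v`. -/
theorem legOff_add_zsmul_right (m j : ℕ) (a b : Fib d) (x' y' v : Fin (d + 1) → ℤ) (i i' : (Fin (d + 1) → ℕ) × ℕ) :
    legOff (Lc ^ (j + m)) (Lc ^ j) a x' i b (y' + ((Lc ^ m : ℕ) : ℤ) • v) i' = legOff (Lc ^ (j + m)) (Lc ^ j) a x' i b y' i' - v := by
  unfold legOff
  rw [legPt_add_zsmul, cast_pow_mul_pow, quo_add_zsmul]
  abel

/-- [folklore] **`Lc^m`-BLOCK-TRANSLATION COVARIANCE OF THE (j, m)-FIBRE FUNCTION, first argument**: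
`kFibM … m j a (x′ + Lc^m•v) b y′ p = e^{ip·v} · kFibM … m j a x′ b y′ p` (every term keeps its inverse-fibre entry and gains the common phase). -/
theorem kFibM_add_zsmul_left (sf sm : ℕ → ℝ) (m j : ℕ) (a b : Fib d) (x' y' v : Fin (d + 1) → ℤ) (p : Fin (d + 1) → ℂ) :
    kFibM Lc sf sm m j a (x' + ((Lc ^ m : ℕ) : ℤ) • v) b y' p = cphase v p * kFibM Lc sf sm m j a x' b y' p := by
  unfold kFibM kFibW
  rw [Finset.mul_sum]
  refine Finset.sum_congr rfl fun ii _ => ?_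
  rw [legOff_add_zsmul_left, cphase_add_eq_mul, legPt_add_zsmul, cast_pow_mul_pow, legIdx_add_zsmul]
  ring

/-- [folklore] **… second argument**: `kFibM … m j a x′ b (y′ + Lc^m•v) p = e^{−ip·v} · kFibM … p`. -/
theorem kFibM_add_zsmul_right (sf sm : ℕ → ℝ) (m j : ℕ) (a b : Fib d) (x' y' v : Fin (d + 1) → ℤ) (p : Fin (d + 1) → ℂ) :
    kFibM Lc sf sm m j a x' b (y' + ((Lc ^ m : ℕ) : ℤ) • v) p = cphase (-v) p * kFibM Lc sf sm m j a x' b y' p := by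
  unfold kFibM kFibW
  rw [Finset.mul_sum]
  refine Finset.sum_congr rfl fun ii _ => ?_
  rw [legOff_add_zsmul_right, sub_eq_add_neg, cphase_add_eq_mul, legPt_add_zsmul, cast_pow_mul_pow, legIdx_add_zsmul]
  ring

/-! ## §2 The re-based (j, m)-fibre function `kFibΔM` and the (j, m)-resolvent at the coarse offset -/

/-- [our object] **THE (j, m)-FIBRE FUNCTION AT THE COARSE (`Lc^m`-BLOCK) OFFSET**: `kFibΔM := cphase (quo (Lc^m) y′ − quo (Lc^m) x′) · kFibM` — the same explicit
finite sum with its phases re-based, so that the (j, m)-resolvent entry `((x′,a),(y′,b))` is `Re latticeKernel kFibΔM (quo (Lc^m) x′ − quo (Lc^m) y′)` and its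
decay in the `Lc^m`-block offset is read off a strip bound.  Explicit; no estimate. -/
def kFibΔM (Lc : ℕ) [NeZero Lc] (sf sm : ℕ → ℝ) (m j : ℕ) (a : Fib d) (x' : Fin (d + 1) → ℤ) (b : Fib d) (y' : Fin (d + 1) → ℤ) :
    (Fin (d + 1) → ℂ) → ℂ :=
  fun p => cphase (quo (Lc ^ m) y' - quo (Lc ^ m) x') p * kFibM Lc sf sm m j a x' b y' p

/-- [folklore] Re-basing the phase: `latticeKernel (kFibM …) 0 = latticeKernel (kFibΔM …) (quo (Lc^m) x′ − quo (Lc^m) y′)`. -/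
theorem latticeKernel_kFibM_zero_eq (sf sm : ℕ → ℝ) (m j : ℕ) (a : Fib d) (x' : Fin (d + 1) → ℤ) (b : Fib d) (y' : Fin (d + 1) → ℤ) :
    latticeKernel (kFibM Lc sf sm m j a x' b y') 0 = latticeKernel (kFibΔM Lc sf sm m j a x' b y') (quo (Lc ^ m) x' - quo (Lc ^ m) y') := by
  have h : kFibM Lc sf sm m j a x' b y' = fun P => cphase (quo (Lc ^ m) x' - quo (Lc ^ m) y') P * kFibΔM Lc sf sm m j a x' b y' P := by
    funext P
    unfold kFibΔM
    rw [← mul_assoc, ← cphase_add_eq_mul, sub_add_sub_cancel, sub_self, cphase_zero_left, one_mul]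
  rw [h, latticeKernel_cphase_mul_zero]

/-- [our object] **THE UNIT-RESCALED (j, m)-RESOLVENT AT THE COARSE OFFSET**:
`unitK (sf j) (sm j) (KTot (Lc^(j+m)) (Lc^j)) x′ y′ a b = [LegOn (Lc^m) a x′ ∧ LegOn (Lc^m) b y′] · Re latticeKernel (kFibΔM … m j a x′ b y′) (quo (Lc^m) x′ − quo (Lc^m) y′)`
(gen 13's `PerfectResolventFibre.unitK_KTot_eq` + the re-basing). -/
theorem unitK_KTot_eq_offset (sf sm : ℕ → ℝ) (m j : ℕ) (x' y' : Fin (d + 1) → ℤ) (a b : Fib d) :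
    unitK (sf j) (sm j) (KTot (d := d) (Lc ^ (j + m)) (Lc ^ j)) x' y' a b =
      if LegOn (Lc ^ m) a x' ∧ LegOn (Lc ^ m) b y' then
        (latticeKernel (kFibΔM Lc sf sm m j a x' b y') (quo (Lc ^ m) x' - quo (Lc ^ m) y')).re else 0 := by
  rw [unitK_KTot_eq, latticeKernel_kFibM_zero_eq]

/-- [folklore] **EXACT INVARIANCE of `kFibΔM`, first argument**: `kFibΔM … (x′ + Lc^m•v) … = kFibΔM … x′ …` (the re-based phase absorbs the shift). -/
theorem kFibΔM_add_zsmul_left (sf sm : ℕ → ℝ) (m j : ℕ) (a b : Fib d) (x' y' v : Fin (d + 1) → ℤ) :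
    kFibΔM Lc sf sm m j a (x' + ((Lc ^ m : ℕ) : ℤ) • v) b y' = kFibΔM Lc sf sm m j a x' b y' := by
  funext p
  unfold kFibΔM
  rw [quo_add_zsmul, kFibM_add_zsmul_left, ← mul_assoc, ← cphase_add_eq_mul]
  congr 2
  abel

/-- [folklore] **EXACT INVARIANCE of `kFibΔM`, second argument**: `kFibΔM … (y′ + Lc^m•v) = kFibΔM … y′`. -/
theorem kFibΔM_add_zsmul_right (sf sm : ℕ → ℝ) (m j : ℕ) (a b : Fib d) (x' y' v : Fin (d + 1) → ℤ) :
    kFibΔM Lc sf sm m j a x' b (y' + ((Lc ^ m : ℕ) : ℤ) • v) = kFibΔM Lc sf sm m j a x' b y' := by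
  funext p
  unfold kFibΔM
  rw [quo_add_zsmul, kFibM_add_zsmul_right, ← mul_assoc, ← cphase_add_eq_mul]
  congr 2
  abel

/-- [folklore] `kFibΔM` along any `Lc^m`-block decomposition of its two base points. -/
theorem kFibΔM_of_decomp (sf sm : ℕ → ℝ) (m j : ℕ) (a b : Fib d) {x' y' r r' q q' : Fin (d + 1) → ℤ}
    (hx : x' = r + ((Lc ^ m : ℕ) : ℤ) • q) (hy : y' = r' + ((Lc ^ m : ℕ) : ℤ) • q') :
    kFibΔM Lc sf sm m j a x' b y' = kFibΔM Lc sf sm m j a r b r' := by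
  subst hx hy
  rw [kFibΔM_add_zsmul_left, kFibΔM_add_zsmul_right]

/-- [folklore] **RESIDUE FORM of `kFibΔM`**: it depends on the base points only through their box representatives mod `Lc^m`. -/
theorem kFibΔM_eq_repZ (sf sm : ℕ → ℝ) (m j : ℕ) (a b : Fib d) (x' y' : Fin (d + 1) → ℤ) :
    kFibΔM Lc sf sm m j a x' b y' = kFibΔM Lc sf sm m j a (repZ (Torus.proj (Lc ^ m) x')) b (repZ (Torus.proj (Lc ^ m) y')) :=
  kFibΔM_of_decomp sf sm m j a b (eq_repZ_add_zsmul_quo (N := Lc ^ m) x') (eq_repZ_add_zsmul_quo (N := Lc ^ m) y')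

/-- [folklore] `kFibΔM` AT BOX REPRESENTATIVES IS `kFibW (Lc^(j+m)) (Lc^j)` (the offset phase is `cphase 0 = 1`). -/
theorem kFibΔM_repZ_eq_kFibW (sf sm : ℕ → ℝ) (m j : ℕ) (a b : Fib d) (zx zy : TorusSite (d + 1) (Lc ^ m)) (p : Fin (d + 1) → ℂ) :
    kFibΔM Lc sf sm m j a (repZ zx) b (repZ zy) p = kFibW (Lc ^ (j + m)) (Lc ^ j) (sf j) (sm j) a (repZ zx) b (repZ zy) p := by
  unfold kFibΔM kFibM
  rw [quo_repZ, quo_repZ, sub_zero, cphase_zero_left, one_mul]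

/-! ## §3 The shape `StripRegularKM` — (I3′) at relative blocking `Lc^m` — and its packaging -/

/-- [shape] **(I3′) AT RELATIVE BLOCKING `Lc^m`**: ONE `κ`, ONE `Cst` such that for every step `j`, all base points and leg indices the re-based (j, m)-fibre
function in the adopted units is `StripRegular` on `Strip (d+1) κ` with bound `Cst` — the exact `m`-analogue of `ConvCKOfShapes.StripRegularK` (road P1 row L10).
A predicate, asserted of NOTHING; discharged at `d = 3` in `GAN24/FibreStripJMHolds`. -/
def StripRegularKM (d Lc : ℕ) [NeZero Lc] (m : ℕ) (κ Cst : ℝ) : Prop :=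
  ∀ (j : ℕ) (x' y' : Fin (d + 1) → ℤ) (a b : Fib d), StripRegular (kFibΔM Lc (sfStep Lc) (smStep d Lc) m j a x' b y') κ Cst

/-- [folklore] THE SHAPE AT BOX REPRESENTATIVES ⇒ THE SHAPE (`kFibΔM_eq_repZ`): per `j`, finitely many conditions (`Lc^{2m(d+1)}` residue pairs × leg types). -/
theorem stripRegularKM_of_repZ {m : ℕ} {κ Cst : ℝ}
    (h : ∀ j (zx zy : TorusSite (d + 1) (Lc ^ m)) (a b : Fib d), StripRegular (kFibΔM Lc (sfStep Lc) (smStep d Lc) m j a (repZ zx) b (repZ zy)) κ Cst) :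
    StripRegularKM d Lc m κ Cst := by
  intro j x' y' a b
  rw [kFibΔM_eq_repZ]
  exact h j _ _ a b

/-- [folklore] `kFibΔM … m j` is strip holomorphic off the zeros of the blocking-`Lc^(j+m)` fibre determinant on `Strip (d+1) κ`. -/
theorem stripHolo_kFibΔM {κ : ℝ} (hκ : 0 ≤ κ) (sf sm : ℕ → ℝ) (m j : ℕ)
    (hdet : ∀ p ∈ Strip (d + 1) κ, (trigPolySymbol (stencil (d + 1)) (pieceMatrix (N := Lc ^ (j + m))) p).det ≠ 0)
    (a : Fib d) (x' : Fin (d + 1) → ℤ) (b : Fib d) (y' : Fin (d + 1) → ℤ) :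
    StripHolo (kFibΔM Lc sf sm m j a x' b y') κ := by
  unfold kFibΔM kFibM
  exact (stripHolo_cphase _ κ).mul (stripHolo_kFibW hκ hdet _ _ _ a x' b y')

/-- [folklore] **`StripRegular (kFibΔM …) κ Cst`** from (U1) no zero of the blocking-`Lc^(j+m)` fibre determinant on the strip and (U2) a DIRECT sup bound `Cst`. -/
theorem stripRegular_kFibΔM {κ Cst : ℝ} (hκ : 0 ≤ κ) (sf sm : ℕ → ℝ) (m j : ℕ)
    (hdet : ∀ p ∈ Strip (d + 1) κ, (trigPolySymbol (stencil (d + 1)) (pieceMatrix (N := Lc ^ (j + m))) p).det ≠ 0)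
    (a : Fib d) (x' : Fin (d + 1) → ℤ) (b : Fib d) (y' : Fin (d + 1) → ℤ)
    (hC : ∀ p ∈ Strip (d + 1) κ, ‖kFibΔM Lc sf sm m j a x' b y' p‖ ≤ Cst) :
    StripRegular (kFibΔM Lc sf sm m j a x' b y') κ Cst :=
  stripRegular_of_stripHolo (stripHolo_kFibΔM hκ sf sm m j hdet a x' b y') hC

/-- [folklore] **THE SHAPE FROM (U1)+(U2)**: (U1) ∀ j, no zero of the blocking-`Lc^(j+m)` fibre determinant on `Strip (d+1) κ`; (U2) ∀ j x′ y′ a b, the sup bound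
`Cst` of `kFibΔM` in the adopted units ⇒ `StripRegularKM d Lc m κ Cst`. -/
theorem stripRegularKM_of_det_bound {m : ℕ} {κ Cst : ℝ} (hκ : 0 ≤ κ)
    (hdet : ∀ j, ∀ p ∈ Strip (d + 1) κ, (trigPolySymbol (stencil (d + 1)) (pieceMatrix (N := Lc ^ (j + m))) p).det ≠ 0)
    (hC : ∀ (j : ℕ) (x' y' : Fin (d + 1) → ℤ) (a b : Fib d), ∀ p ∈ Strip (d + 1) κ,
      ‖kFibΔM Lc (sfStep Lc) (smStep d Lc) m j a x' b y' p‖ ≤ Cst) :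
    StripRegularKM d Lc m κ Cst :=
  fun j x' y' a b => stripRegular_kFibΔM hκ _ _ m j (hdet j) a x' b y' (hC j x' y' a b)

/-- [folklore] The shape forces `0 ≤ Cst`. -/
theorem cst_nonneg_of_stripRegularKM {m : ℕ} {κ Cst : ℝ} (hκ : 0 ≤ κ) (h : StripRegularKM d Lc m κ Cst) : 0 ≤ Cst :=
  (norm_nonneg _).trans ((h 0 0 0 (Sum.inl 0) (Sum.inl 0)).bound _ (ofRealVec_mem_Strip hκ (FibreInverseDecay.BZ_nonempty (d + 1)).some_mem))

/-! ## §4 The shape ⇒ the `j`-UNIFORM `Decays` bound of the (j, m)-family (the binder `hK` at relative blocking `Lc^m`) -/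

/-- **(I3′) AT RELATIVE BLOCKING `Lc^m` ⇒ THE `j`-UNIFORM DECAY OF THE UNIT-RESCALED (j, m)-RESOLVENTS** [our object]: `StripRegularKM d Lc m κ Cst` with `κ ≥ 0` gives
`UniformDecays (j ↦ unitK (sfStep Lc j) (smStep d Lc j) (KTot (Lc^(j+m)) (Lc^j))) (Cst·e^{2κ}) (κ∕((d+1)·Lc^m))` (Paley–Wiener: pv17's `latticeKernel_decay` on the
`Lc^m`-block offset, sup-norm → `ℓ¹` rate `κ∕(d+1)` on the offset → `κ∕((d+1)·Lc^m)` on the step-`j` lattice) — `CombesThomasFibreStep.unitDecayK_of_stripRegular` at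
blocking `Lc^m`; LITERALLY the hypothesis `hK` of `FP.TransportInfinityM.entryHyps_perfCol` ∕ `FP.SymmetryK.kernelSide_KPerf` at `(sf, sm) := (sfStep Lc, smStep d Lc)`. -/
theorem uniformDecays_of_stripRegularKM {m : ℕ} {κ Cst : ℝ} (hκ : 0 ≤ κ) (h : StripRegularKM d Lc m κ Cst) :
    UniformDecays (fun j => unitK (sfStep Lc j) (smStep d Lc j) (KTot (d := d) (Lc ^ (j + m)) (Lc ^ j)))
      (Cst * Real.exp (2 * κ)) (κ / ((d + 1) * (Lc : ℝ) ^ m)) := by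
  intro j x' y' a b
  have hCst : 0 ≤ Cst := cst_nonneg_of_stripRegularKM hκ h
  have hLm : (0 : ℝ) < (Lc : ℝ) ^ m := pow_pos (by exact_mod_cast Nat.pos_of_ne_zero (NeZero.ne Lc)) m
  dsimp only
  rw [unitK_KTot_eq_offset]
  split_ifs with hc
  · have h1 := latticeKernel_decay (h j x' y' a b) hκ (quo (Lc ^ m) x' - quo (Lc ^ m) y')
    have h2 := h1.trans (mul_le_mul_of_nonneg_left (FibreInverseDecay.exp_supNorm_le_exp_l1 hκ _) hCst)
    have h3 := l1_sub_le_coarse (Lc := Lc ^ m) x' y'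
    rw [Nat.cast_pow] at h3
    refine (Complex.abs_re_le_norm _).trans (h2.trans ?_)
    rw [mul_assoc]
    refine mul_le_mul_of_nonneg_left ?_ hCst
    rw [← Real.exp_add]
    refine Real.exp_le_exp.2 ?_
    have hd : (0 : ℝ) < (d + 1 : ℝ) := by positivity
    have hkd : 0 ≤ κ / ((d + 1 : ℝ) * (Lc : ℝ) ^ m) := div_nonneg hκ (by positivity)
    have key : κ / ((d + 1) * (Lc : ℝ) ^ m) * l1 (x' - y') ≤ κ / (d + 1) * l1 (quo (Lc ^ m) x' - quo (Lc ^ m) y') + 2 * κ := by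
      calc κ / ((d + 1) * (Lc : ℝ) ^ m) * l1 (x' - y')
          ≤ κ / ((d + 1) * (Lc : ℝ) ^ m) * ((Lc : ℝ) ^ m * l1 (quo (Lc ^ m) x' - quo (Lc ^ m) y') + 2 * ((Lc : ℝ) ^ m * (d + 1))) :=
            mul_le_mul_of_nonneg_left h3 hkd
        _ = κ / (d + 1) * l1 (quo (Lc ^ m) x' - quo (Lc ^ m) y') + 2 * κ := by field_simp
    show -(κ / (↑d + 1)) * l1 (quo (Lc ^ m) x' - quo (Lc ^ m) y') ≤ 2 * κ + -(κ / ((↑d + 1) * (↑Lc) ^ m)) * l1 (x' - y')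
    linarith
  · rw [abs_zero]; positivity

/-! ## §5 With the real-zone rate: the `Decays`-currency Cauchy rate of the (j, m)-family (the binder `hKall` at relative blocking `Lc^m`) -/

/-- [our object] Gen 13's one-step sup-norm rate of the (j, m)-family (`PerfectResolventFibre.abs_KTot_succ_sub_le`) in `CombesThomas.SupRate` form. -/
theorem supRate_of_realRateKM {m : ℕ} {c θ : ℝ} (hθ0 : 0 ≤ θ) (hB : RealRateKM d Lc m c θ) :
    SupRate (fun j => unitK (sfStep Lc j) (smStep d Lc j) (KTot (d := d) (Lc ^ (j + m)) (Lc ^ j))) c θ := by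
  intro j x' y' a b
  rw [HessKerDressedLimit.mker_sub_apply]
  exact abs_KTot_succ_sub_le hθ0 hB j x' y' a b

/-- **(I3′) AND (I2′) AT RELATIVE BLOCKING `Lc^m` ⇒ THE WALL's CAUCHY RATE OF THE (j, m)-FAMILY** [our object] (`0 ≤ κ`, `0 ≤ θ < 1`):
`DecayCauchy (j ↦ unitK (sfStep Lc j) (smStep d Lc j) (KTot (Lc^(j+m)) (Lc^j))) (√(2(c∕(1−θ))·(Cst·e^{2κ}))) (√θ) (κ∕((d+1)·Lc^m)∕2)` —
`CombesThomas.decayCauchy_of_uniformDecays_supRate` BY NAME; LITERALLY the hypothesis `hKall` of `FP.TransportInfinityM.entryHyps_perfCol` ∕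
`FP.SymmetryK.refK_KPerf_of_decays` at the adopted units. -/
theorem decayCauchy_of_stripRegularKM_realRateKM {m : ℕ} {κ Cst c θ : ℝ} (hκ : 0 ≤ κ) (hA : StripRegularKM d Lc m κ Cst)
    (hθ0 : 0 ≤ θ) (hθ1 : θ < 1) (hB : RealRateKM d Lc m c θ) :
    DecayCauchy (fun j => unitK (sfStep Lc j) (smStep d Lc j) (KTot (d := d) (Lc ^ (j + m)) (Lc ^ j)))
      (Real.sqrt (2 * (c / (1 - θ)) * (Cst * Real.exp (2 * κ)))) (Real.sqrt θ) (κ / ((d + 1) * (Lc : ℝ) ^ m) / 2) :=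
  decayCauchy_of_uniformDecays_supRate (uniformDecays_of_stripRegularKM hκ hA) (supRate_of_realRateKM hθ0 hB)
    (c_nonneg_of_realRateKM hB) hθ0 hθ1

end Summit.QuantumFields.BalabanUV.Beta.GAN24.FibreStripJM

end
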